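import Mathlib
import Summits.Ventures.HodgeRepro.Tier4.Common.AdelicDefs
import Summits.Ventures.HodgeRepro.Tier4.Common.AdelicPlaces
import Summits.Ventures.HodgeRepro.Tier4.Common.CongruenceAdeles
import Summits.Ventures.HodgeRepro.Tier4.Common.CompactOpenLevel
import Summits.Ventures.HodgeRepro.Tier4.Line1.PlaneDefs
import Summits.Ventures.HodgeRepro.Tier4.Line1.AdelicParts
import Summits.Ventures.HodgeRepro.Tier4.Line1.FiniteLevelIsolation
import Summits.Ventures.HodgeRepro.Tier4.Line4.FinitePlacePositivity

/-!
# Tier4/Line4/TransporterDichotomy — the rational dichotomy behind C-L4-TRANSPORTER-SEP: for a linearly regular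
`γ₀` the conjugate `γ₀⁻¹ s₀ γ₀` of the reflection `s₀ = P 0 − P 1 ∈ T(k)` does not commute with both `Q j`

Blind re-derivation cell `pub-hodge-repro`, Tier 4 (README §9–§10), seat t4-L2-p3 (gen 4), cut C-L4-TRANSPORTER-SEP
(plan-4 g5 S15186 (2), statement S15285).  Tree path `lean/Summits/Ventures/HodgeRepro/Tier4/Line4/TransporterDichotomy.lean`.

* §2 the rational reflection `P 0 − P 1`: an involution (`reflMat_mul_self`), unitary for a genuine row plane
  (`reflMat_comm_Ω`, `reflMat_form`), commuting with both projectors of `T` (`reflMat_comm_P`), hence an element of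
  `T(k) ≤ G(𝔸)` through `GA.ofRationalMat` (`reflPt_mem_torusT`);
* §3 `adMat (P 0)` is not an adelic `E′`-scalar `x·1 + y·Ω` (`adMat_P_zero_ne_scalar`): `P 0 ∉ span_k{1, Ω}`
  (`(a + bΩ)(a − bΩ) = (a² + d b²)·1`, so an `E′`-scalar is `0` or invertible while `rank (P 0) = 2`), a `k`-linear
  functional killing `span{1, Ω}` but not `P 0` (`Submodule.exists_dual_map_eq_bot_of_notMem`), extended `𝔸`-linearly;
* §4 **the dichotomy** (`exists_commutator_ne_zero`, `exists_reflMat_commutator_ne_zero`): if `γ₀⁻¹ P₀ γ₀` commuted with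
  both `Q j`, `IsLinRegular` applied to `Y = adMat P₀`, `Y′ = γ₀⁻¹ Y γ₀` would make `adMat P₀` an `E′`-scalar — so for
  some `j` the RATIONAL commutator `[u⁻¹ (P 0 − P 1) u, Q j]` is non-zero (`u` the rational matrix of `γ₀`,
  `exists_rational_gl`).  This is plan-4's «(b) = rational dichotomy + base change»: no local line count.
No printed input is consumed.  HC_CM is NOT proved by anyone in this repository.
-/

set_option autoImplicit false

noncomputable section

namespace Summit.Ventures.HodgeRepro.Tier4.Line4

open Summit.Ventures.HodgeRepro.Tier4 Summit.Ventures.HodgeRepro.Tier4.Common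
  Summit.Ventures.HodgeRepro.Tier4.Line1
open NumberField IsDedekindDomain Topology Filter Matrix
open scoped NumberField Pointwise

variable {k : Type} [Field k] [NumberField k] (W : PlaneData k)

/-! ### 2. The rational reflection `P 0 − P 1 ∈ T(k)` -/

omit [NumberField k] in
/-- `P 0 · P 1 = 0`. -/
theorem P_mul_zero_one_eq_zero : W.P 0 * W.P 1 = 0 := by
  have h1 : W.P 1 = 1 - W.P 0 := by rw [← W.P_sum]; abel
  rw [h1, mul_sub, mul_one, W.P_idem 0, sub_self]

omit [NumberField k] in
/-- `P 1 · P 0 = 0`. -/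
theorem P_mul_one_zero_eq_zero : W.P 1 * W.P 0 = 0 := by
  have h1 : W.P 1 = 1 - W.P 0 := by rw [← W.P_sum]; abel
  rw [h1, sub_mul, one_mul, W.P_idem 0, sub_self]

omit [NumberField k] in
/-- `reflMat² = 1`. -/
theorem reflMat_mul_self : (W.P 0 - W.P 1) * (W.P 0 - W.P 1) = 1 := by
  rw [sub_mul, mul_sub, mul_sub, W.P_idem 0, W.P_idem 1, P_mul_zero_one_eq_zero, P_mul_one_zero_eq_zero, ← W.P_sum]
  abel

omit [NumberField k] in
/-- `det reflMat ≠ 0`. -/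
theorem reflMat_det_ne_zero : (W.P 0 - W.P 1).det ≠ 0 := by
  intro h
  have := congrArg Matrix.det (reflMat_mul_self W)
  rw [Matrix.det_mul, h, zero_mul, Matrix.det_one] at this
  exact zero_ne_one this

omit [NumberField k] in
/-- `reflMat` commutes with `Ω`. -/
theorem reflMat_comm_Ω : (W.P 0 - W.P 1) * W.Ω = W.Ω * (W.P 0 - W.P 1) := by
  rw [sub_mul, mul_sub, W.P_comm 0, W.P_comm 1]

omit [NumberField k] in
/-- `reflMat` preserves the form when the projectors are `B`-self-adjoint. -/
theorem reflMat_form (hP : ∀ i, W.P i * W.B = W.B * (W.P i)ᵀ) :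
    (W.P 0 - W.P 1) * W.B * (W.P 0 - W.P 1)ᵀ = W.B := by
  have h : W.B * (W.P 0 - W.P 1)ᵀ = (W.P 0 - W.P 1) * W.B := by
    rw [Matrix.transpose_sub, mul_sub, sub_mul, hP 0, hP 1]
  rw [mul_assoc, h, ← mul_assoc, reflMat_mul_self, one_mul]

omit [NumberField k] in
/-- `reflMat` commutes with both projectors of `T`. -/
theorem reflMat_comm_P : ∀ i : Fin 2, (W.P 0 - W.P 1) * W.P i = W.P i * (W.P 0 - W.P 1) := by
  refine Fin.forall_fin_two.2 ⟨?_, ?_⟩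
  · rw [sub_mul, mul_sub, W.P_idem 0, P_mul_one_zero_eq_zero, P_mul_zero_one_eq_zero]
  · rw [sub_mul, mul_sub, W.P_idem 1, P_mul_zero_one_eq_zero, P_mul_one_zero_eq_zero]

omit [NumberField k] in
/-- `reflMat = 2 P 0 − 1`. -/
theorem reflMat_eq : W.P 0 - W.P 1 = (2 : k) • W.P 0 - 1 := by
  rw [← W.P_sum, two_smul]
  abel

/-- The matrix of the reflection `GA.ofRationalMat W (P 0 − P 1) …`. -/
theorem mat_reflPt (hP : ∀ i, W.P i * W.B = W.B * (W.P i)ᵀ) :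
    GA.mat W (GA.ofRationalMat W (W.P 0 - W.P 1) (reflMat_det_ne_zero W) (reflMat_comm_Ω W) (reflMat_form W hP)) =
      adMat k (W.P 0 - W.P 1) := rfl

/-- The reflection lies in `T`. -/
theorem reflPt_mem_torusT (hP : ∀ i, W.P i * W.B = W.B * (W.P i)ᵀ) :
    GA.ofRationalMat W (W.P 0 - W.P 1) (reflMat_det_ne_zero W) (reflMat_comm_Ω W) (reflMat_form W hP) ∈ torusT W := by
  refine Subgroup.mem_inf.2 ⟨?_, ?_⟩
  · show adMat k (W.P 0 - W.P 1) * adMat k (W.P 0) = adMat k (W.P 0) * adMat k (W.P 0 - W.P 1)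
    rw [← adMat_mul, ← adMat_mul, reflMat_comm_P W]
  · show adMat k (W.P 0 - W.P 1) * adMat k (W.P 1) = adMat k (W.P 1) * adMat k (W.P 0 - W.P 1)
    rw [← adMat_mul, ← adMat_mul, reflMat_comm_P W]

/-! ### 3. `P 0` is not an `E′`-scalar, adelically -/

/-- `algebraMap k (Ad k)` is injective (through the finite part). -/
theorem algebraMap_adeleRing_injective : Function.Injective (algebraMap k (Ad k)) := by
  intro a b h
  apply algebraMap_finiteAdele_injective
  rw [← finPart_algebraMap, ← finPart_algebraMap, h]

omit [NumberField k] in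
/-- `P 0 ∉ span_k {1, Ω}` for a genuine plane: `(a + bΩ)(a − bΩ) = (a² + d b²)·1`, so an `E′`-scalar is `0` or
invertible, while `rank (P 0) = 2`. -/
theorem P_zero_notMem_span (hg : IsGenuineRow W) :
    W.P 0 ∉ Submodule.span k {(1 : Matrix (Fin 4) (Fin 4) k), W.Ω} := by
  obtain ⟨⟨d, hΩ, hd⟩, -, -, -, hPrank, -⟩ := hg
  intro hmem
  obtain ⟨a, b, hab⟩ := Submodule.mem_span_pair.1 hmem
  have hprod : (a • (1 : Matrix (Fin 4) (Fin 4) k) + b • W.Ω) * (a • (1 : Matrix (Fin 4) (Fin 4) k) - b • W.Ω) =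
      (a * a + d * (b * b)) • (1 : Matrix (Fin 4) (Fin 4) k) := by
    simp only [add_mul, mul_sub, smul_mul_assoc, mul_smul_comm, one_mul, mul_one, hΩ, smul_smul, smul_neg,
      smul_add]
    module
  have hrank := hPrank 0
  by_cases h0 : a * a + d * (b * b) = 0
  · by_cases hb : b = 0
    · subst hb
      have ha : a = 0 := by simpa using h0
      subst ha
      have hP0 : W.P 0 = 0 := by rw [← hab]; simp
      rw [hP0, Matrix.rank_zero] at hrank
      exact absurd hrank (by norm_num)
    · apply hd
      refine ⟨a / b, ?_⟩
      have haa : a * a = -(d * (b * b)) := by linear_combination h0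
      rw [div_mul_div_comm, haa, neg_div, mul_div_assoc, div_self (mul_ne_zero hb hb), mul_one]
  · have hmul : W.P 0 * ((a * a + d * (b * b))⁻¹ • (a • (1 : Matrix (Fin 4) (Fin 4) k) - b • W.Ω)) = 1 := by
      rw [← hab, mul_smul_comm, hprod, smul_smul, inv_mul_cancel₀ h0, one_smul]
    have hunit : IsUnit (W.P 0) :=
      (Matrix.isUnit_iff_isUnit_det _).2 (Matrix.isUnit_det_of_right_inverse hmul)
    rw [Matrix.rank_of_isUnit _ hunit] at hrank
    simp at hrank

omit [NumberField k] in
/-- A `k`-linear functional on `M₄(k)` killing `1` and `Ω` but not `P 0`. -/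
theorem exists_dual_P_zero (hg : IsGenuineRow W) :
    ∃ f : Module.Dual k (Matrix (Fin 4) (Fin 4) k), f (W.P 0) ≠ 0 ∧ f 1 = 0 ∧ f W.Ω = 0 := by
  obtain ⟨f, hf, hmap⟩ := Submodule.exists_dual_map_eq_bot_of_notMem (P_zero_notMem_span W hg) inferInstance
  have hkill : ∀ m ∈ Submodule.span k {(1 : Matrix (Fin 4) (Fin 4) k), W.Ω}, f m = 0 := by
    intro m hm
    have : f m ∈ (Submodule.span k {(1 : Matrix (Fin 4) (Fin 4) k), W.Ω}).map f := Submodule.mem_map_of_mem hm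
    rw [hmap] at this
    exact (Submodule.mem_bot k).1 this
  exact ⟨f, hf, hkill _ (Submodule.subset_span (by simp)), hkill _ (Submodule.subset_span (by simp))⟩

/-- **`adMat (P 0)` is not an adelic `E′`-scalar**: a `k`-linear functional killing `1`, `Ω` but not `P 0`,
extended `𝔸`-linearly as `X ↦ ∑ f(E_ij) X_ij`, separates them. -/
theorem adMat_P_zero_ne_scalar (hg : IsGenuineRow W) (x y : Ad k) :
    adMat k (W.P 0) ≠ x • (1 : M4 k) + y • adMat k W.Ω := by
  obtain ⟨f, hf, hf1, hfΩ⟩ := exists_dual_P_zero W hg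
  obtain ⟨F, hF⟩ : ∃ F : M4 k → Ad k,
      F = fun X => ∑ i, ∑ j, algebraMap k (Ad k) (f (Matrix.single i j 1)) * X i j := ⟨_, rfl⟩
  have hFad : ∀ A : Matrix (Fin 4) (Fin 4) k, F (adMat k A) = algebraMap k (Ad k) (f A) := by
    intro A
    have hA : f A = ∑ i, ∑ j, f (Matrix.single i j 1) * A i j := by
      conv_lhs => rw [Matrix.matrix_eq_sum_single A]
      rw [map_sum]
      refine Finset.sum_congr rfl fun i _ => ?_
      rw [map_sum]
      refine Finset.sum_congr rfl fun j _ => ?_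
      have : Matrix.single i j (A i j) = A i j • Matrix.single i j (1 : k) := by
        rw [Matrix.smul_single, smul_eq_mul, mul_one]
      rw [this, map_smul, smul_eq_mul, mul_comm]
    rw [hF, hA, map_sum]
    refine Finset.sum_congr rfl fun i _ => ?_
    rw [map_sum]
    refine Finset.sum_congr rfl fun j _ => ?_
    rw [map_mul]
    rfl
  have hFadd : ∀ X Y : M4 k, F (X + Y) = F X + F Y := by
    intro X Y
    rw [hF]
    simp only [Matrix.add_apply, mul_add, Finset.sum_add_distrib]
  have hFsmul : ∀ (z : Ad k) (X : M4 k), F (z • X) = z * F X := by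
    intro z X
    rw [hF]
    simp only [Matrix.smul_apply, smul_eq_mul, Finset.mul_sum]
    refine Finset.sum_congr rfl fun i _ => Finset.sum_congr rfl fun j _ => ?_
    ring
  intro h
  have h1 : F (adMat k (W.P 0)) = algebraMap k (Ad k) (f (W.P 0)) := hFad _
  have h2 : F (x • (1 : M4 k) + y • adMat k W.Ω) = 0 := by
    rw [hFadd, hFsmul, hFsmul, ← adMat_one, hFad, hFad, hf1, hfΩ, map_zero, mul_zero, mul_zero, add_zero]
  rw [h, h2] at h1
  exact hf (algebraMap_adeleRing_injective h1.symm)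

/-! ### 4. The rational dichotomy: `[γ₀⁻¹ P₀ γ₀, Q j] ≠ 0` for a linearly regular `γ₀` -/

/-- The rational matrix of a rational point and its inverse. -/
theorem exists_rational_gl (γ : rationalPoints W) :
    ∃ u : GL (Fin 4) k, GA.mat W (γ : GA W) = adMat k (u : Matrix (Fin 4) (Fin 4) k) ∧
      GA.mat W ((γ : GA W)⁻¹) = adMat k ((u⁻¹ : GL (Fin 4) k) : Matrix (Fin 4) (Fin 4) k) := by
  obtain ⟨u, hu⟩ := (MonoidHom.mem_range).1 ((Subgroup.mem_subgroupOf).1 γ.2)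
  refine ⟨u, ?_, ?_⟩
  · show (((γ : GA W) : GL4 k) : M4 k) = _
    rw [← hu]
    rfl
  · change (Units.val (Subtype.val ((γ : GA W)⁻¹)) : M4 k) = _
    rw [Subgroup.coe_inv, ← hu, ← map_inv]
    rfl

/-- **The rational dichotomy** (linear regularity ⇒ `γ₀⁻¹ P₀ γ₀` does not commute with both `Q j`): for some `j`,
`[u⁻¹ P₀ u, Q j] ≠ 0` where `u` is the rational matrix of `γ₀`. -/
theorem exists_commutator_ne_zero (hg : IsGenuineRow W) (γ₀ : rationalPoints W) (hreg : IsLinRegular W γ₀)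
    (u : GL (Fin 4) k) (hu : GA.mat W (γ₀ : GA W) = adMat k (u : Matrix (Fin 4) (Fin 4) k)) :
    ∃ j : Fin 2, ((u⁻¹ : GL (Fin 4) k) : Matrix (Fin 4) (Fin 4) k) * W.P 0 * u * W.Q j ≠
      W.Q j * (((u⁻¹ : GL (Fin 4) k) : Matrix (Fin 4) (Fin 4) k) * W.P 0 * u) := by
  by_contra hcon
  have hcon' : ∀ j : Fin 2, ((u⁻¹ : GL (Fin 4) k) : Matrix (Fin 4) (Fin 4) k) * W.P 0 * u * W.Q j =
      W.Q j * (((u⁻¹ : GL (Fin 4) k) : Matrix (Fin 4) (Fin 4) k) * W.P 0 * u) :=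
    fun j => of_not_not fun hne => hcon ⟨j, hne⟩
  set X : Matrix (Fin 4) (Fin 4) k := ((u⁻¹ : GL (Fin 4) k) : Matrix (Fin 4) (Fin 4) k) * W.P 0 * u with hX
  have hcomm : (u : Matrix (Fin 4) (Fin 4) k) * W.Ω = W.Ω * u := by
    apply Line1.adMat_injective
    rw [adMat_mul, adMat_mul, ← hu]
    exact ((mem_unitaryGroup W _).1 (γ₀ : GA W).2).1
  have hcomm' : ((u⁻¹ : GL (Fin 4) k) : Matrix (Fin 4) (Fin 4) k) * W.Ω = W.Ω * (u⁻¹ : GL (Fin 4) k) := by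
    calc ((u⁻¹ : GL (Fin 4) k) : Matrix (Fin 4) (Fin 4) k) * W.Ω
        = (u⁻¹ : GL (Fin 4) k) * W.Ω * ((u : Matrix (Fin 4) (Fin 4) k) * (u⁻¹ : GL (Fin 4) k)) := by
          rw [Units.mul_inv, mul_one]
      _ = (u⁻¹ : GL (Fin 4) k) * (W.Ω * u) * (u⁻¹ : GL (Fin 4) k) := by simp only [mul_assoc]
      _ = (u⁻¹ : GL (Fin 4) k) * (u * W.Ω) * (u⁻¹ : GL (Fin 4) k) := by rw [hcomm]
      _ = ((u⁻¹ : GL (Fin 4) k) * u) * W.Ω * (u⁻¹ : GL (Fin 4) k) := by simp only [mul_assoc]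
      _ = W.Ω * (u⁻¹ : GL (Fin 4) k) := by rw [Units.inv_mul, one_mul]
  have hXΩ : X * W.Ω = W.Ω * X := by
    calc X * W.Ω = (u⁻¹ : GL (Fin 4) k) * W.P 0 * ((u : Matrix (Fin 4) (Fin 4) k) * W.Ω) := by
          rw [hX, mul_assoc]
      _ = (u⁻¹ : GL (Fin 4) k) * W.P 0 * (W.Ω * u) := by rw [hcomm]
      _ = (u⁻¹ : GL (Fin 4) k) * (W.P 0 * W.Ω) * u := by simp only [mul_assoc]
      _ = (u⁻¹ : GL (Fin 4) k) * (W.Ω * W.P 0) * u := by rw [W.P_comm 0]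
      _ = ((u⁻¹ : GL (Fin 4) k) * W.Ω) * W.P 0 * u := by simp only [mul_assoc]
      _ = (W.Ω * (u⁻¹ : GL (Fin 4) k)) * W.P 0 * u := by rw [hcomm']
      _ = W.Ω * X := by rw [hX]; simp only [mul_assoc]
  have h1 : adMat k (W.P 0) * adMat k W.Ω = adMat k W.Ω * adMat k (W.P 0) := by
    rw [← adMat_mul, ← adMat_mul, W.P_comm 0]
  have h2 : ∀ i, adMat k (W.P 0) * adMat k (W.P i) = adMat k (W.P i) * adMat k (W.P 0) := by
    refine Fin.forall_fin_two.2 ⟨rfl, ?_⟩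
    rw [← adMat_mul, ← adMat_mul, P_mul_zero_one_eq_zero, P_mul_one_zero_eq_zero]
  have h3 : adMat k X * adMat k W.Ω = adMat k W.Ω * adMat k X := by
    rw [← adMat_mul, ← adMat_mul, hXΩ]
  have h4 : ∀ i, adMat k X * adMat k (W.Q i) = adMat k (W.Q i) * adMat k X := by
    intro i
    rw [← adMat_mul, ← adMat_mul, hcon' i]
  have h5 : adMat k (W.P 0) * GA.mat W (γ₀ : GA W) = GA.mat W (γ₀ : GA W) * adMat k X := by
    rw [hu, ← adMat_mul, ← adMat_mul, hX]
    congr 1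
    simp only [← mul_assoc, Units.mul_inv, one_mul]
  obtain ⟨x, y, hY, -⟩ := hreg (adMat k (W.P 0)) (adMat k X) h1 h2 h3 h4 h5
  exact adMat_P_zero_ne_scalar W hg x y hY

/-- The same for the reflection: `[u⁻¹ s₀ u, Q j] ≠ 0` for some `j` (`s₀ = 2 P₀ − 1`). -/
theorem exists_reflMat_commutator_ne_zero (hg : IsGenuineRow W) (γ₀ : rationalPoints W)
    (hreg : IsLinRegular W γ₀) (u : GL (Fin 4) k)
    (hu : GA.mat W (γ₀ : GA W) = adMat k (u : Matrix (Fin 4) (Fin 4) k)) :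
    ∃ j : Fin 2, ((u⁻¹ : GL (Fin 4) k) : Matrix (Fin 4) (Fin 4) k) * (W.P 0 - W.P 1) * u * W.Q j ≠
      W.Q j * (((u⁻¹ : GL (Fin 4) k) : Matrix (Fin 4) (Fin 4) k) * (W.P 0 - W.P 1) * u) := by
  obtain ⟨j, hj⟩ := exists_commutator_ne_zero W hg γ₀ hreg u hu
  refine ⟨j, fun h => hj ?_⟩
  have hX : ((u⁻¹ : GL (Fin 4) k) : Matrix (Fin 4) (Fin 4) k) * (W.P 0 - W.P 1) * u =
      (2 : k) • (((u⁻¹ : GL (Fin 4) k) : Matrix (Fin 4) (Fin 4) k) * W.P 0 * u) - 1 := by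
    rw [reflMat_eq, mul_sub, sub_mul, mul_smul_comm, smul_mul_assoc, mul_one, Units.inv_mul]
  rw [hX, sub_mul, mul_sub, smul_mul_assoc, mul_smul_comm, one_mul, mul_one] at h
  have h2 := sub_left_inj.1 h
  have h3 := congrArg (fun m : Matrix (Fin 4) (Fin 4) k => (2 : k)⁻¹ • m) h2
  simpa [smul_smul] using h3

end Summit.Ventures.HodgeRepro.Tier4.Line4

end
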